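/-
Copyright (c) 2026. All rights reserved.
Released under Apache 2.0 license as described in the file LICENSE.
Authors: abc-iut cell, seat abc-iut-w6-d025 (gen 2; block C / W6, row «Cor36-LOGOBS-TELE»).
-/
import Literature.AnabelianGeometry.AbsoluteAnabelian.AbsTopIII.FrobeniusPictureMLFLogTeleFamilyThird
import Literature.AnabelianGeometry.AbsoluteAnabelian.AbsTopIII.FrobeniusPictureMLFCompatibilityTransport

/-!
# [AbsTopIII] Cor. 3.6 (iii), second clause, telecore half: the telecore-free sub-diagram of `𝒟_An`
# is a sub-diagram of `𝒟`

S. Mochizuki, *Topics in Absolute Anabelian Geometry III*, Cor. 3.6 (ii)/(iii) pp. 79–80 of the kurims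
manuscript (`paper:url-5493eb38cbb7`; bib key `MochizukiAbsTopIII2015`).  First step of the
instantiation of `logObsCompatTelecoreStmt_of_family'` (`FrobeniusPictureMLFLogTeleFamilyThird.lean`)
by a family on the whole diagram `𝒟` (e.g. the glue family of `FrobeniusPictureMLFLogGlueFamily.lean`):
the graph embedding `jD : Γ⃗_𝒮 ↪ Γ⃗_𝒟` of the telecore-free graph (`FVtx`, the graph of
`(𝒟_{≤5}, Anab)`) into the graph of `𝒟` (`embCore5` after unwrapping), the EQUALITY of diagrams
`jS^*𝒟_An = jD^*𝒟` (`teleDiagram_comapAlong_jS`, by `DiagramOfCategories.ext'` — same categories and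
functors, vertex by vertex and edge by edge), and the factorisation `embLog = jD ∘ logToF` of the
embedding of `𝒟_{≤3}` (`logToF_comp_jD`).  With these, a family `K` on `𝒟` pulls back to a family
`teleDiagram_comapAlong_jS ▸ K.comap jD` on `jS^*𝒟_An` containing (along `logToF`) whatever `K` contains
along `embLog` (next file).  Pure bookkeeping; nothing here takes a side on inter-universal Teichmüller
theory or bears on [IUTchIII] Cor. 3.12.
-/

namespace Literature.AnabelianGeometry.AbsoluteAnabelian

open _root_.CategoryTheory _root_.Quiver

universe u

namespace LogFrobeniusData

open DiagramOfCategories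

variable (Δ : LogFrobeniusData.{u}) (τ : Δ.TelecoreData)

/-- `Γ⃗_𝒮 ↪ Γ⃗_𝒟`: the telecore-free graph of `𝒟_An` (= the graph of `(𝒟_{≤5}, Anab)`) into the graph
of `𝒟` (`embCore5` after unwrapping). [cite: MochizukiAbsTopIII2015, Corollary 3.6 (i) p.79] -/
def jD : FVtx.{u} ⥤q LFVertex where
  obj x := embCore5.{u}.obj x.v
  map {x y} e := match x, y, e with
    | ⟨ExtVertex.base _⟩, ⟨ExtVertex.base _⟩, e => e
    | ⟨ExtVertex.base ⟨.fourth, _⟩⟩, ⟨ExtVertex.obs⟩, _ => LFVertex.edge45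
    | ⟨ExtVertex.base ⟨.row1 _, _⟩⟩, ⟨ExtVertex.obs⟩, i => PEmpty.elim i
    | ⟨ExtVertex.base ⟨.nexus, _⟩⟩, ⟨ExtVertex.obs⟩, i => PEmpty.elim i
    | ⟨ExtVertex.base ⟨.third, _⟩⟩, ⟨ExtVertex.obs⟩, i => PEmpty.elim i
    | ⟨ExtVertex.base ⟨.fifth, _⟩⟩, ⟨ExtVertex.obs⟩, i => PEmpty.elim i
    | ⟨ExtVertex.base ⟨.sixth, _⟩⟩, ⟨ExtVertex.obs⟩, i => PEmpty.elim i
    | ⟨ExtVertex.obs⟩, ⟨ExtVertex.base _⟩, j => PEmpty.elim j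
    | ⟨ExtVertex.obs⟩, ⟨ExtVertex.obs⟩, e => PEmpty.elim e

/-- **The telecore-free sub-diagram `jS^*𝒟_An` IS the sub-diagram `jD^*𝒟` of `𝒟`.**
[cite: MochizukiAbsTopIII2015, Corollary 3.6 (ii) p.79] -/
theorem teleDiagram_comapAlong_jS :
    (Δ.teleDiagram anJ (Δ.anTelMap τ)).comapAlong jS.{u} = Δ.diagram.comapAlong jD.{u} := by
  refine DiagramOfCategories.ext' (fun x => ?_) (fun x => ?_) (fun e => ?_)
  · obtain ⟨v⟩ := x
    rcases v with _ | _ <;> rfl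
  · obtain ⟨v⟩ := x
    rcases v with _ | _ <;> exact HEq.rfl
  · rename_i x y
    obtain ⟨a⟩ := x
    obtain ⟨b⟩ := y
    revert e
    rcases a with ⟨_ | _ | _ | _ | _ | _, _⟩ | _ <;> rcases b with _ | _ <;> intro e <;>
      first | exact (PEmpty.elim e) | exact HEq.rfl

/-- `logToF` followed by `jD` is `embLog`. [cite: MochizukiAbsTopIII2015, Corollary 3.6 (iii) p.80] -/
theorem logToF_comp_jD : logToF.{u} ⋙q jD.{u} = embLog := by
  fapply Prefunctor.ext
  · intro a
    rcases a with _ | _ <;> rfl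
  · intro a b e
    revert e
    rcases a with ⟨_ | _ | _ | _ | _ | _, _⟩ | _ <;> rcases b with ⟨_, _⟩ | _ <;> intro e <;>
      first | exact (PEmpty.elim e) | rfl

end LogFrobeniusData

end Literature.AnabelianGeometry.AbsoluteAnabelian
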